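import Literature.Probability.LatticeModels.DobrushinShlosmanComparison
import Mathlib.Analysis.SpecificLimits.Basic
import HarnessLib

/-!
# The Dobrushin–Shlosman window comparison under the PER-WINDOW received sum: super-solutions, geometric
# decay along a profile, and DEFECTS (two functionals that are only ALMOST invariant under the windows)

Abstract part (finite cell type `ι`, no measure theory), continuing `DobrushinShlosmanComparison.lean` (estimates
`|E₁ F − E₂ F| ≤ Σ_x a x δ x`, the single-window update `upd_c`, the averaged step).  The contraction file
`DobrushinShlosmanContraction.lean` works under Dobrushin–Shlosman's AVERAGED condition `C_V`
(`Σ_{c ∋ x} Σ_y k c y x ≤ γ₀ |{c ∋ x}|`), where the boundary layer of partially usable centres forces the time-dependent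
three-zone invariant and the rate `κ₁ = (1−γ₀)²/(2(2γ₀N⋆+1))`.  Under the PER-WINDOW condition

  `Σ_y k c y x ≤ γ₀ < 1` for every USABLE centre `c` and every `x ∈ win c`

(Föllmer's row-sum condition, window by window — what every lattice door of the programme certifies) the honest
argument is Föllmer's own (1988, Ch. I, (2.7)–(2.10), Remark (2.11)): a SUPER-SOLUTION `d ≥ 0` of the window system,

  (S1) `Σ_y k c y x · d y + κ c x ≤ d x` for every usable `c` and `x ∈ win c`,
  (S2) `R ≤ d x` at every cell `x` covered by no usable window,

dominates the comparison: `|E₁ F − E₂ F| ≤ Σ_x d x δ x` (`abs_sub_le_superSolution`).  Here `κ c x ≥ 0` is a DEFECT array: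
the second functional need only satisfy `|E₂ (T c F) − E₂ F| ≤ Σ_{x ∈ win c} κ c x δ x` at the usable centres (`κ = 0`:
exact invariance, the setting of the tree so far).  PROOF: the affine iteration `a ↦ step a + (ε/|ι|) G`,
`G x = Σ_{usable c ∋ x} κ c x`, maps nonnegative estimates to estimates (`stepD_estimate`, the dusting step plus the
defect); `d` is a fixed super-solution of it (`stepD_le_of_superSolution`), and the excess `(R − d)₊` of the initial
estimate over `d` lives on covered cells, where the averaged step contracts it in sup-norm by
`β = 1 − ε(1−γ₀)/|ι| < 1` per step while leaving it zero on the uncovered cells (`iterate_step_excess_le`); `m → ∞`.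
COROLLARY (`abs_sub_le_geometric`, `κ = 0`): with a profile `ℓ : ι → ℕ` such that every window through a cell of
positive profile is usable and `ℓ` drops by at most one along the support of `k`, the vector `d x = R γ₀^{ℓ x}` is a
super-solution, whence `|E₁ F − E₂ F| ≤ R Σ_x γ₀^{ℓ x} δ x` — rate `log(1/γ₀)` per profile level and constant `R`, in
place of `2R e^{−κ₁ L₀}`.

References: H. Föllmer, *Random fields and diffusion processes*, LNM 1362 (1988), Ch. I, (2.7)–(2.11), Thm. (2.8);
R. L. Dobrushin, S. B. Shlosman (1985), Thm. 1 (the window setting); the tree files `DobrushinShlosmanComparison.lean`,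
`DobrushinShlosmanContraction.lean`, `DobrushinComparisonDefect.lean` (the single-site defect comparison).
-/

open Finset

noncomputable section

namespace Literature.Probability.LatticeModels.DobrushinShlosman

variable {ι Ω : Type*} [Fintype ι] [DecidableEq ι]
variable {R : ℝ} {Adm : (Ω → ℝ) → Prop} {Lip : (Ω → ℝ) → (ι → ℝ) → Prop} {T : ι → (Ω → ℝ) → (Ω → ℝ)}
  {win : ι → Finset ι} {k : ι → ι → ι → ℝ} {κ : ι → ι → ℝ} {U : Finset ι} {E₁ E₂ : (Ω → ℝ) → ℝ}

/-! ### Bookkeeping for the single-window update -/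

/-- The dual bookkeeping of the window dusting: for nonnegative `a`, `δ`,
`Σ_y a y · δ'_y ≤ Σ_x (upd_c a) x · δ x`, where `δ'` is the dusted vector (`0` on `win c`,
`δ y + Σ_{x ∈ win c} k c y x δ x` off it) and `upd_c a` the single-window update (`a` off `win c`,
`x ↦ Σ_y k c y x a y` on it). [cite: Follmer1988, Ch. I Lemma (2.5)] -/
theorem sum_mul_dust_le_sum_upd_mul (hk : ∀ c y x, 0 ≤ k c y x) {a δ : ι → ℝ} (ha0 : ∀ x, 0 ≤ a x)
    (hδ0 : ∀ x, 0 ≤ δ x) (c : ι) :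
    ∑ y, a y * (if y ∈ win c then 0 else δ y + ∑ x ∈ win c, k c y x * δ x) ≤
      ∑ x, (if x ∈ win c then ∑ y, k c y x * a y else a x) * δ x := by
  -- adapted from `upd_estimate` (the bookkeeping half)
  have h1 : ∑ y, a y * (if y ∈ win c then 0 else δ y + ∑ x ∈ win c, k c y x * δ x) =
      ∑ y, (if y ∈ win c then 0 else a y * δ y) +
        ∑ y, (if y ∈ win c then 0 else ∑ x ∈ win c, a y * k c y x * δ x) := by
    rw [← Finset.sum_add_distrib]
    refine Finset.sum_congr rfl fun y _ => ?_
    split_ifs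
    · simp
    · rw [mul_add, Finset.mul_sum]
      exact congrArg _ (Finset.sum_congr rfl fun x _ => by ring)
  have h2 : ∑ y, (if y ∈ win c then 0 else ∑ x ∈ win c, a y * k c y x * δ x) ≤
      ∑ y, ∑ x ∈ win c, a y * k c y x * δ x := by
    refine Finset.sum_le_sum fun y _ => ?_
    split_ifs
    · exact Finset.sum_nonneg fun x _ => mul_nonneg (mul_nonneg (ha0 y) (hk c y x)) (hδ0 x)
    · exact le_rfl
  have h3 : ∑ x, (if x ∈ win c then ∑ y, k c y x * a y else a x) * δ x =
      ∑ x, (if x ∈ win c then 0 else a x * δ x) + ∑ x ∈ win c, (∑ y, k c y x * a y) * δ x := by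
    rw [← Finset.sum_add_sum_compl (win c)
        (fun x => (if x ∈ win c then ∑ y, k c y x * a y else a x) * δ x),
      ← Finset.sum_add_sum_compl (win c) (fun x => if x ∈ win c then 0 else a x * δ x)]
    have e1 : ∑ x ∈ win c, (if x ∈ win c then ∑ y, k c y x * a y else a x) * δ x =
        ∑ x ∈ win c, (∑ y, k c y x * a y) * δ x :=
      Finset.sum_congr rfl fun x hx => by rw [if_pos hx]
    have e2 : ∑ x ∈ (win c)ᶜ, (if x ∈ win c then ∑ y, k c y x * a y else a x) * δ x =
        ∑ x ∈ (win c)ᶜ, a x * δ x :=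
      Finset.sum_congr rfl fun x hx => by rw [if_neg (Finset.mem_compl.1 hx)]
    have e3 : ∑ x ∈ win c, (if x ∈ win c then 0 else a x * δ x) = 0 :=
      Finset.sum_eq_zero fun x hx => if_pos hx
    have e4 : ∑ x ∈ (win c)ᶜ, (if x ∈ win c then 0 else a x * δ x) = ∑ x ∈ (win c)ᶜ, a x * δ x :=
      Finset.sum_congr rfl fun x hx => if_neg (Finset.mem_compl.1 hx)
    rw [e1, e2, e3, e4]
    ring
  have h4 : ∑ y, ∑ x ∈ win c, a y * k c y x * δ x = ∑ x ∈ win c, (∑ y, k c y x * a y) * δ x := by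
    rw [Finset.sum_comm]
    refine Finset.sum_congr rfl fun x _ => ?_
    rw [Finset.sum_mul]
    exact Finset.sum_congr rfl fun y _ => by ring
  rw [h1, h3, ← h4]
  exact add_le_add le_rfl h2

/-! ### The single-window update with a defect -/

/-- **Window dusting step with a DEFECT.** If `E₁` is invariant under the usable window operator `T c` and `E₂` is
ALMOST invariant — `|E₂ (T c F) − E₂ F| ≤ Σ_{x ∈ win c} κ c x δ x` — then the single-window update of a nonnegative
estimate `a`, PLUS the defect `κ c ·` on the window, is an estimate:
`|E₁ F − E₂ F| ≤ Σ_x (upd_c a x + 𝟙[x ∈ win c] κ c x) δ x` (Föllmer 1988 Ch. I (2.10): the comparison of two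
specifications picks up the distance of the local characteristics). [cite: Follmer1988, Ch. I (2.10)] -/
theorem upd_estimate_defect (hlip0 : ∀ ⦃F : Ω → ℝ⦄ ⦃δ : ι → ℝ⦄, Lip F δ → ∀ x, 0 ≤ δ x)
    (hk : ∀ c y x, 0 ≤ k c y x) (hT : ∀ ⦃F : Ω → ℝ⦄ (c : ι), Adm F → Adm (T c F))
    (hdust : ∀ ⦃F : Ω → ℝ⦄ ⦃δ : ι → ℝ⦄ (c : ι), Adm F → Lip F δ →
      Lip (T c F) fun y => if y ∈ win c then 0 else δ y + ∑ x ∈ win c, k c y x * δ x)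
    (h₁T : ∀ ⦃F : Ω → ℝ⦄ (c : ι), c ∈ U → Adm F → E₁ (T c F) = E₁ F)
    (h₂D : ∀ ⦃F : Ω → ℝ⦄ ⦃δ : ι → ℝ⦄ (c : ι), c ∈ U → Adm F → Lip F δ →
      |E₂ (T c F) - E₂ F| ≤ ∑ x ∈ win c, κ c x * δ x)
    {a : ι → ℝ} (ha : ∀ ⦃F : Ω → ℝ⦄ ⦃δ : ι → ℝ⦄, Adm F → Lip F δ → |E₁ F - E₂ F| ≤ ∑ x, a x * δ x)
    (ha0 : ∀ x, 0 ≤ a x) {c : ι} (hc : c ∈ U) ⦃F : Ω → ℝ⦄ ⦃δ : ι → ℝ⦄ (hF : Adm F) (hδ : Lip F δ) :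
    |E₁ F - E₂ F| ≤
      ∑ x, ((if x ∈ win c then ∑ y, k c y x * a y else a x) + (if x ∈ win c then κ c x else 0)) * δ x := by
  have key := ha (hT c hF) (hdust c hF hδ)
  rw [h₁T c hc hF] at key
  have hdef := h₂D c hc hF hδ
  have htri : |E₁ F - E₂ F| ≤ |E₁ F - E₂ (T c F)| + |E₂ (T c F) - E₂ F| := abs_sub_le _ _ _
  have hbook := sum_mul_dust_le_sum_upd_mul (win := win) hk ha0 (hlip0 hδ) c
  have hκ : ∑ x ∈ win c, κ c x * δ x = ∑ x, (if x ∈ win c then κ c x else 0) * δ x := by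
    symm
    calc ∑ x, (if x ∈ win c then κ c x else 0) * δ x = ∑ x, (if x ∈ win c then κ c x * δ x else 0) :=
          Finset.sum_congr rfl fun x _ => by split_ifs <;> simp
      _ = ∑ x ∈ win c, κ c x * δ x := by rw [Finset.sum_ite_mem, Finset.univ_inter]
  calc |E₁ F - E₂ F| ≤ |E₁ F - E₂ (T c F)| + |E₂ (T c F) - E₂ F| := htri
    _ ≤ ∑ x, (if x ∈ win c then ∑ y, k c y x * a y else a x) * δ x +
        ∑ x, (if x ∈ win c then κ c x else 0) * δ x := add_le_add (key.trans hbook) (hdef.trans hκ.le)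
    _ = _ := by rw [← Finset.sum_add_distrib]; exact Finset.sum_congr rfl fun x _ => by ring

/-! ### The averaged step with defects -/

/-- **The averaged step with defects maps nonnegative estimates to estimates**:
`stepD a x = step a x + (ε/|ι|) Σ_{usable c ∋ x} κ c x` (the averaged dusting step of `DobrushinShlosmanComparison`
plus the averaged defect). [cite: Follmer1988, Ch. I Lemma (2.5)] -/
theorem stepD_estimate (hlip0 : ∀ ⦃F : Ω → ℝ⦄ ⦃δ : ι → ℝ⦄, Lip F δ → ∀ x, 0 ≤ δ x)
    (hk : ∀ c y x, 0 ≤ k c y x) (hT : ∀ ⦃F : Ω → ℝ⦄ (c : ι), Adm F → Adm (T c F))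
    (hdust : ∀ ⦃F : Ω → ℝ⦄ ⦃δ : ι → ℝ⦄ (c : ι), Adm F → Lip F δ →
      Lip (T c F) fun y => if y ∈ win c then 0 else δ y + ∑ x ∈ win c, k c y x * δ x)
    (h₁T : ∀ ⦃F : Ω → ℝ⦄ (c : ι), c ∈ U → Adm F → E₁ (T c F) = E₁ F)
    (h₂D : ∀ ⦃F : Ω → ℝ⦄ ⦃δ : ι → ℝ⦄ (c : ι), c ∈ U → Adm F → Lip F δ →
      |E₂ (T c F) - E₂ F| ≤ ∑ x ∈ win c, κ c x * δ x)
    {ε : ℝ} (hε0 : 0 ≤ ε) (hε1 : ε ≤ 1) {stepD : (ι → ℝ) → ι → ℝ}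
    (hstepD : ∀ a x, stepD a x = (1 - ε * U.card / Fintype.card ι) * a x +
      ε / Fintype.card ι * ∑ c ∈ U, ((if x ∈ win c then ∑ y, k c y x * a y else a x) +
        (if x ∈ win c then κ c x else 0)))
    {a : ι → ℝ} (ha : ∀ ⦃F : Ω → ℝ⦄ ⦃δ : ι → ℝ⦄, Adm F → Lip F δ → |E₁ F - E₂ F| ≤ ∑ x, a x * δ x)
    (ha0 : ∀ x, 0 ≤ a x) ⦃F : Ω → ℝ⦄ ⦃δ : ι → ℝ⦄ (hF : Adm F) (hδ : Lip F δ) :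
    |E₁ F - E₂ F| ≤ ∑ x, stepD a x * δ x := by
  -- adapted from `step_estimate`
  have hw := step_weight_nonneg U hε1 (ι := ι)
  have hq : 0 ≤ ε / Fintype.card ι := div_nonneg hε0 (Nat.cast_nonneg _)
  set u : ι → ι → ℝ := fun c x =>
    (if x ∈ win c then ∑ y, k c y x * a y else a x) + (if x ∈ win c then κ c x else 0) with hu
  have hA : (1 - ε * U.card / Fintype.card ι) * |E₁ F - E₂ F| ≤
      (1 - ε * U.card / Fintype.card ι) * ∑ x, a x * δ x :=
    mul_le_mul_of_nonneg_left (ha hF hδ) hw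
  have hB : ∀ c ∈ U, ε / Fintype.card ι * |E₁ F - E₂ F| ≤ ε / Fintype.card ι * ∑ x, u c x * δ x :=
    fun c hc => mul_le_mul_of_nonneg_left (upd_estimate_defect hlip0 hk hT hdust h₁T h₂D ha ha0 hc hF hδ) hq
  have hsum := Finset.sum_le_sum hB
  rw [Finset.sum_const, nsmul_eq_mul] at hsum
  have hsplit : |E₁ F - E₂ F| = (1 - ε * U.card / Fintype.card ι) * |E₁ F - E₂ F| +
      U.card * (ε / Fintype.card ι * |E₁ F - E₂ F|) := by ring
  have hexp : ∑ x, stepD a x * δ x = (1 - ε * U.card / Fintype.card ι) * ∑ x, a x * δ x +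
      ∑ c ∈ U, ε / Fintype.card ι * ∑ x, u c x * δ x := by
    calc ∑ x, stepD a x * δ x
        = ∑ x, ((1 - ε * U.card / Fintype.card ι) * (a x * δ x) +
            ε / Fintype.card ι * ∑ c ∈ U, u c x * δ x) :=
          Finset.sum_congr rfl fun x _ => by rw [hstepD, ← Finset.sum_mul]; ring
      _ = ∑ x, (1 - ε * U.card / Fintype.card ι) * (a x * δ x) +
            ∑ x, ε / Fintype.card ι * ∑ c ∈ U, u c x * δ x := Finset.sum_add_distrib
      _ = (1 - ε * U.card / Fintype.card ι) * ∑ x, a x * δ x + ε / Fintype.card ι *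
            ∑ x, ∑ c ∈ U, u c x * δ x := by rw [← Finset.mul_sum, ← Finset.mul_sum]
      _ = (1 - ε * U.card / Fintype.card ι) * ∑ x, a x * δ x + ε / Fintype.card ι *
            ∑ c ∈ U, ∑ x, u c x * δ x := by rw [Finset.sum_comm]
      _ = _ := by rw [Finset.mul_sum U]
  rw [hexp, hsplit]
  exact add_le_add hA hsum

/-! ### Elementary properties of the averaged step (no defects) -/

section Step

variable {ε : ℝ} {step : (ι → ℝ) → ι → ℝ}

/-- The averaged step is additive. [folklore] -/
private theorem step_add (hstep : ∀ a x, step a x = (1 - ε * U.card / Fintype.card ι) * a x +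
      ε / Fintype.card ι * ∑ c ∈ U, (if x ∈ win c then ∑ y, k c y x * a y else a x))
    (a b : ι → ℝ) (x : ι) : step (fun y => a y + b y) x = step a x + step b x := by
  rw [hstep, hstep, hstep]
  have h1 : ∑ c ∈ U, (if x ∈ win c then ∑ y, k c y x * (a y + b y) else a x + b x) =
      ∑ c ∈ U, (if x ∈ win c then ∑ y, k c y x * a y else a x) +
        ∑ c ∈ U, (if x ∈ win c then ∑ y, k c y x * b y else b x) := by
    rw [← Finset.sum_add_distrib]
    refine Finset.sum_congr rfl fun c _ => ?_
    split_ifs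
    · rw [← Finset.sum_add_distrib]; exact Finset.sum_congr rfl fun y _ => by ring
    · rfl
  rw [h1]
  ring

/-- The averaged step is monotone (for `ε ≤ 1`). [folklore] -/
private theorem step_mono (hk : ∀ c y x, 0 ≤ k c y x) (hε0 : 0 ≤ ε) (hε1 : ε ≤ 1)
    (hstep : ∀ a x, step a x = (1 - ε * U.card / Fintype.card ι) * a x +
      ε / Fintype.card ι * ∑ c ∈ U, (if x ∈ win c then ∑ y, k c y x * a y else a x))
    {a b : ι → ℝ} (hab : ∀ x, a x ≤ b x) (x : ι) : step a x ≤ step b x := by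
  rw [hstep, hstep]
  refine add_le_add (mul_le_mul_of_nonneg_left (hab x) (step_weight_nonneg U hε1)) ?_
  refine mul_le_mul_of_nonneg_left (Finset.sum_le_sum fun c _ => ?_) (div_nonneg hε0 (Nat.cast_nonneg _))
  split_ifs
  · exact Finset.sum_le_sum fun y _ => mul_le_mul_of_nonneg_left (hab y) (hk c y x)
  · exact hab x

/-- Splitting the usable centres at `x` into those whose window contains `x` and the others. [folklore] -/
private theorem sum_ite_win_eq (a : ι → ℝ) (x : ι) :
    ∑ c ∈ U, (if x ∈ win c then ∑ y, k c y x * a y else a x) =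
      ∑ c ∈ U.filter (fun c => x ∈ win c), ∑ y, k c y x * a y +
        ((U.filter fun c => x ∉ win c).card : ℝ) * a x := by
  -- adapted from `step_le`
  rw [← Finset.sum_filter_add_sum_filter_not U (fun c => x ∈ win c)]
  congr 1
  · exact Finset.sum_congr rfl fun c hc => by rw [if_pos (Finset.mem_filter.1 hc).2]
  · rw [← nsmul_eq_mul, ← Finset.sum_const]
    exact Finset.sum_congr rfl fun c hc => by rw [if_neg (Finset.mem_filter.1 hc).2]

/-- The step at a cell covered by no usable window is the identity. [folklore] -/
private theorem step_apply_of_uncovered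
    (hstep : ∀ a x, step a x = (1 - ε * U.card / Fintype.card ι) * a x +
      ε / Fintype.card ι * ∑ c ∈ U, (if x ∈ win c then ∑ y, k c y x * a y else a x))
    (a : ι → ℝ) {x : ι} (hx : ∀ c ∈ U, x ∉ win c) : step a x = a x := by
  rw [hstep]
  have h1 : ∑ c ∈ U, (if x ∈ win c then ∑ y, k c y x * a y else a x) = (U.card : ℝ) * a x := by
    rw [← nsmul_eq_mul, ← Finset.sum_const]
    exact Finset.sum_congr rfl fun c hc => if_neg (hx c hc)
  rw [h1]
  rcases Nat.eq_zero_or_pos (Fintype.card ι) with h0 | hpos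
  · have : IsEmpty ι := Fintype.card_eq_zero_iff.1 h0
    exact (this.false x).elim
  · have hι : (Fintype.card ι : ℝ) ≠ 0 := by exact_mod_cast hpos.ne'
    field_simp
    ring

/-- **Sup-norm contraction of the averaged step on the covered cells** under the PER-WINDOW received sum
`Σ_y k c y x ≤ γ₀` (usable `c`, `x ∈ win c`): a vector `w ≤ M` (`M ≥ 0`) that vanishes at the cells covered by no
usable window satisfies `step w ≤ (1 − ε(1−γ₀)/|ι|) M` and still vanishes at the uncovered cells.
[cite: Follmer1988, Ch. I (2.7)] -/
theorem step_le_of_vanish_uncovered (hk : ∀ c y x, 0 ≤ k c y x) (hε0 : 0 ≤ ε) (hε1 : ε ≤ 1)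
    (hstep : ∀ a x, step a x = (1 - ε * U.card / Fintype.card ι) * a x +
      ε / Fintype.card ι * ∑ c ∈ U, (if x ∈ win c then ∑ y, k c y x * a y else a x))
    {γ₀ : ℝ} (hγ₀ : 0 ≤ γ₀) (hγ₁ : γ₀ ≤ 1) (hsumw : ∀ c ∈ U, ∀ x ∈ win c, ∑ y, k c y x ≤ γ₀)
    {w : ι → ℝ} {M : ℝ} (hM : 0 ≤ M) (hwM : ∀ x, w x ≤ M)
    (hwz : ∀ x, (∀ c ∈ U, x ∉ win c) → w x = 0) (x : ι) :
    step w x ≤ (1 - ε * (1 - γ₀) / Fintype.card ι) * M ∧ ((∀ c ∈ U, x ∉ win c) → step w x = 0) := by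
  refine ⟨?_, fun hx => by rw [step_apply_of_uncovered hstep w hx, hwz x hx]⟩
  have hιpos : (0 : ℝ) < Fintype.card ι := by exact_mod_cast Fintype.card_pos_iff.2 ⟨x⟩
  set q : ℝ := ε / Fintype.card ι with hq
  have hq0 : 0 ≤ q := div_nonneg hε0 hιpos.le
  by_cases hx : ∀ c ∈ U, x ∉ win c
  · rw [step_apply_of_uncovered hstep w hx, hwz x hx]
    refine mul_nonneg ?_ hM
    rw [sub_nonneg, div_le_one hιpos]
    have h1 : ε * (1 - γ₀) ≤ 1 := by nlinarith
    exact h1.trans (by exact_mod_cast Fintype.card_pos_iff.2 ⟨x⟩)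
  -- a covered cell: at least one usable window through `x`, each contributing `≤ γ₀ M`
  push Not at hx
  obtain ⟨c₀, hc₀U, hxc₀⟩ := hx
  set n : ℕ := (U.filter fun c => x ∈ win c).card with hn
  have hn1 : (1 : ℝ) ≤ n := by
    have : 1 ≤ n := Finset.card_pos.2 ⟨c₀, Finset.mem_filter.2 ⟨hc₀U, hxc₀⟩⟩
    exact_mod_cast this
  have hnU : (n : ℝ) ≤ U.card := by exact_mod_cast Finset.card_filter_le U _
  have hcard : ((U.filter fun c => x ∉ win c).card : ℝ) = U.card - n := by
    have h := Finset.card_filter_add_card_filter_not (s := U) (fun c => x ∈ win c)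
    rw [eq_sub_iff_add_eq, add_comm]
    exact_mod_cast h
  have hin : ∑ c ∈ U.filter (fun c => x ∈ win c), ∑ y, k c y x * w y ≤ n * (γ₀ * M) := by
    calc ∑ c ∈ U.filter (fun c => x ∈ win c), ∑ y, k c y x * w y
        ≤ ∑ c ∈ U.filter (fun c => x ∈ win c), γ₀ * M := by
          refine Finset.sum_le_sum fun c hc => ?_
          obtain ⟨hcU, hxc⟩ := Finset.mem_filter.1 hc
          calc ∑ y, k c y x * w y ≤ ∑ y, k c y x * M :=
                Finset.sum_le_sum fun y _ => mul_le_mul_of_nonneg_left (hwM y) (hk c y x)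
            _ = (∑ y, k c y x) * M := by rw [Finset.sum_mul]
            _ ≤ γ₀ * M := mul_le_mul_of_nonneg_right (hsumw c hcU x hxc) hM
      _ = n * (γ₀ * M) := by rw [Finset.sum_const, nsmul_eq_mul]
  rw [hstep, sum_ite_win_eq, hcard]
  have hUι : ε * U.card / Fintype.card ι ≤ 1 := by
    rw [div_le_one hιpos]
    calc ε * U.card ≤ 1 * U.card := mul_le_mul_of_nonneg_right hε1 (Nat.cast_nonneg _)
      _ ≤ Fintype.card ι := by rw [one_mul]; exact_mod_cast Finset.card_le_univ U
  have e : (1 - ε * U.card / Fintype.card ι) * w x + q * (∑ c ∈ U.filter (fun c => x ∈ win c),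
      ∑ y, k c y x * w y + (U.card - n) * w x) =
      (1 - q * n) * w x + q * ∑ c ∈ U.filter (fun c => x ∈ win c), ∑ y, k c y x * w y := by
    rw [hq]; ring
  rw [e]
  have hqn : q * n ≤ 1 := by
    calc q * n ≤ q * U.card := mul_le_mul_of_nonneg_left hnU hq0
      _ = ε * U.card / Fintype.card ι := by rw [hq]; ring
      _ ≤ 1 := hUι
  have h1 : (1 - q * n) * w x ≤ (1 - q * n) * M := mul_le_mul_of_nonneg_left (hwM x) (by linarith)
  have h2 : q * ∑ c ∈ U.filter (fun c => x ∈ win c), ∑ y, k c y x * w y ≤ q * (n * (γ₀ * M)) :=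
    mul_le_mul_of_nonneg_left hin hq0
  have h3 : (1 - q * n) * M + q * (n * (γ₀ * M)) ≤ (1 - ε * (1 - γ₀) / Fintype.card ι) * M := by
    have e2 : (1 - ε * (1 - γ₀) / Fintype.card ι) * M = (1 - q * (1 - γ₀)) * M := by rw [hq]; ring
    rw [e2]
    have : 0 ≤ q * (1 - γ₀) * M * (n - 1) := by
      have : 0 ≤ (n : ℝ) - 1 := by linarith
      have : 0 ≤ 1 - γ₀ := by linarith
      positivity
    nlinarith
  linarith

/-- **The excess iterate**: started at a nonnegative vector `w ≤ M` vanishing at the uncovered cells, the `m`-th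
iterate of the averaged step is nonnegative, vanishes at the uncovered cells and is `≤ (1 − ε(1−γ₀)/|ι|)^m M`.
[cite: Follmer1988, Ch. I (2.7)] -/
theorem iterate_step_excess_le (hk : ∀ c y x, 0 ≤ k c y x) (hε0 : 0 ≤ ε) (hε1 : ε ≤ 1)
    (hstep : ∀ a x, step a x = (1 - ε * U.card / Fintype.card ι) * a x +
      ε / Fintype.card ι * ∑ c ∈ U, (if x ∈ win c then ∑ y, k c y x * a y else a x))
    {γ₀ : ℝ} (hγ₀ : 0 ≤ γ₀) (hγ₁ : γ₀ ≤ 1) (hsumw : ∀ c ∈ U, ∀ x ∈ win c, ∑ y, k c y x ≤ γ₀)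
    {w : ι → ℝ} {M : ℝ} (hM : 0 ≤ M) (hw0 : ∀ x, 0 ≤ w x) (hwM : ∀ x, w x ≤ M)
    (hwz : ∀ x, (∀ c ∈ U, x ∉ win c) → w x = 0) (m : ℕ) (x : ι) :
    0 ≤ step^[m] w x ∧ step^[m] w x ≤ (1 - ε * (1 - γ₀) / Fintype.card ι) ^ m * M ∧
      ((∀ c ∈ U, x ∉ win c) → step^[m] w x = 0) := by
  induction m generalizing x with
  | zero => exact ⟨hw0 x, by simpa using hwM x, hwz x⟩
  | succ m ih =>
    rw [Function.iterate_succ_apply']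
    have hβ0 : 0 ≤ (1 - ε * (1 - γ₀) / Fintype.card ι) ^ m * M := by
      refine mul_nonneg (pow_nonneg ?_ m) hM
      have hιpos : (0 : ℝ) < Fintype.card ι := by exact_mod_cast Fintype.card_pos_iff.2 ⟨x⟩
      rw [sub_nonneg, div_le_one hιpos]
      have h1 : ε * (1 - γ₀) ≤ 1 := by nlinarith
      exact h1.trans (by exact_mod_cast Fintype.card_pos_iff.2 ⟨x⟩)
    have h := step_le_of_vanish_uncovered hk hε0 hε1 hstep hγ₀ hγ₁ hsumw hβ0
      (fun y => (ih y).2.1) (fun y hy => (ih y).2.2 hy) x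
    refine ⟨step_nonneg hk hε0 hε1 hstep (fun y => (ih y).1) x, ?_, h.2⟩
    calc step (step^[m] w) x ≤ (1 - ε * (1 - γ₀) / Fintype.card ι) * ((1 - ε * (1 - γ₀) / Fintype.card ι) ^ m * M) :=
          h.1
      _ = (1 - ε * (1 - γ₀) / Fintype.card ι) ^ (m + 1) * M := by rw [pow_succ]; ring

end Step

/-! ### The iteration with defects and its domination by a super-solution -/

/-- All iterates of the step with defects started at a nonnegative constant are nonnegative (`κ ≥ 0`). [folklore] -/
private theorem iterate_stepD_nonneg (hk : ∀ c y x, 0 ≤ k c y x) (hκ0 : ∀ c x, 0 ≤ κ c x) {ε : ℝ} (hε0 : 0 ≤ ε)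
    (hε1 : ε ≤ 1) {stepD : (ι → ℝ) → ι → ℝ}
    (hstepD : ∀ a x, stepD a x = (1 - ε * U.card / Fintype.card ι) * a x +
      ε / Fintype.card ι * ∑ c ∈ U, ((if x ∈ win c then ∑ y, k c y x * a y else a x) +
        (if x ∈ win c then κ c x else 0)))
    (hR : 0 ≤ R) (m : ℕ) (x : ι) : 0 ≤ stepD^[m] (fun _ => R) x := by
  induction m generalizing x with
  | zero => exact hR
  | succ m ih =>
    rw [Function.iterate_succ_apply', hstepD]
    refine add_nonneg (mul_nonneg (step_weight_nonneg U hε1) (ih x))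
      (mul_nonneg (div_nonneg hε0 (Nat.cast_nonneg _)) (Finset.sum_nonneg fun c _ => add_nonneg ?_ ?_))
    · split_ifs
      · exact Finset.sum_nonneg fun y _ => mul_nonneg (hk c y x) (ih y)
      · exact ih x
    · split_ifs
      · exact hκ0 c x
      · exact le_rfl

/-- **All iterates of the step with defects are estimates**, for `E₁` invariant and `E₂` almost invariant under
the usable window operators. [cite: Follmer1988, Ch. I Theorem (2.8)] -/
theorem iterate_stepD_estimate (hR : 0 ≤ R) (hlip0 : ∀ ⦃F : Ω → ℝ⦄ ⦃δ : ι → ℝ⦄, Lip F δ → ∀ x, 0 ≤ δ x)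
    (hosc : ∀ ⦃F : Ω → ℝ⦄ ⦃δ : ι → ℝ⦄, Adm F → Lip F δ → ∀ σ τ, |F σ - F τ| ≤ R * ∑ x, δ x)
    (hk : ∀ c y x, 0 ≤ k c y x) (hκ0 : ∀ c x, 0 ≤ κ c x) (hT : ∀ ⦃F : Ω → ℝ⦄ (c : ι), Adm F → Adm (T c F))
    (hdust : ∀ ⦃F : Ω → ℝ⦄ ⦃δ : ι → ℝ⦄ (c : ι), Adm F → Lip F δ →
      Lip (T c F) fun y => if y ∈ win c then 0 else δ y + ∑ x ∈ win c, k c y x * δ x)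
    (h₁le : ∀ ⦃F : Ω → ℝ⦄ ⦃M : ℝ⦄, Adm F → (∀ σ, F σ ≤ M) → E₁ F ≤ M)
    (h₁ge : ∀ ⦃F : Ω → ℝ⦄ ⦃M : ℝ⦄, Adm F → (∀ σ, M ≤ F σ) → M ≤ E₁ F)
    (h₁T : ∀ ⦃F : Ω → ℝ⦄ (c : ι), c ∈ U → Adm F → E₁ (T c F) = E₁ F)
    (h₂le : ∀ ⦃F : Ω → ℝ⦄ ⦃M : ℝ⦄, Adm F → (∀ σ, F σ ≤ M) → E₂ F ≤ M)
    (h₂ge : ∀ ⦃F : Ω → ℝ⦄ ⦃M : ℝ⦄, Adm F → (∀ σ, M ≤ F σ) → M ≤ E₂ F)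
    (h₂D : ∀ ⦃F : Ω → ℝ⦄ ⦃δ : ι → ℝ⦄ (c : ι), c ∈ U → Adm F → Lip F δ →
      |E₂ (T c F) - E₂ F| ≤ ∑ x ∈ win c, κ c x * δ x)
    {ε : ℝ} (hε0 : 0 ≤ ε) (hε1 : ε ≤ 1) {stepD : (ι → ℝ) → ι → ℝ}
    (hstepD : ∀ a x, stepD a x = (1 - ε * U.card / Fintype.card ι) * a x +
      ε / Fintype.card ι * ∑ c ∈ U, ((if x ∈ win c then ∑ y, k c y x * a y else a x) +
        (if x ∈ win c then κ c x else 0)))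
    (m : ℕ) ⦃F : Ω → ℝ⦄ ⦃δ : ι → ℝ⦄ (hF : Adm F) (hδ : Lip F δ) :
    |E₁ F - E₂ F| ≤ ∑ x, stepD^[m] (fun _ => R) x * δ x := by
  induction m generalizing F δ with
  | zero => exact const_estimate hosc h₁le h₁ge h₂le h₂ge hF hδ
  | succ m ih =>
    rw [Function.iterate_succ_apply']
    exact stepD_estimate hlip0 hk hT hdust h₁T h₂D hε0 hε1 hstepD ih
      (iterate_stepD_nonneg hk hκ0 hε0 hε1 hstepD hR m) hF hδ

/-- **A super-solution is a fixed super-point of the step with defects**: (S1)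
`Σ_y k c y x d y + κ c x ≤ d x` (usable `c`, `x ∈ win c`) gives `stepD d ≤ d`. [cite: Follmer1988, Ch. I Remark (2.11)] -/
theorem stepD_le_of_superSolution {ε : ℝ} (hε0 : 0 ≤ ε) {stepD : (ι → ℝ) → ι → ℝ}
    (hstepD : ∀ a x, stepD a x = (1 - ε * U.card / Fintype.card ι) * a x +
      ε / Fintype.card ι * ∑ c ∈ U, ((if x ∈ win c then ∑ y, k c y x * a y else a x) +
        (if x ∈ win c then κ c x else 0)))
    {d : ι → ℝ} (hdS : ∀ c ∈ U, ∀ x ∈ win c, ∑ y, k c y x * d y + κ c x ≤ d x) (x : ι) :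
    stepD d x ≤ d x := by
  rw [hstepD]
  have h1 : ∑ c ∈ U, ((if x ∈ win c then ∑ y, k c y x * d y else d x) + (if x ∈ win c then κ c x else 0)) ≤
      ∑ _c ∈ U, d x := by
    refine Finset.sum_le_sum fun c hc => ?_
    split_ifs with hxc
    · exact hdS c hc x hxc
    · simp
  rw [Finset.sum_const, nsmul_eq_mul] at h1
  have hq : 0 ≤ ε / Fintype.card ι := div_nonneg hε0 (Nat.cast_nonneg _)
  calc (1 - ε * U.card / Fintype.card ι) * d x + ε / Fintype.card ι *
        ∑ c ∈ U, ((if x ∈ win c then ∑ y, k c y x * d y else d x) + (if x ∈ win c then κ c x else 0))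
      ≤ (1 - ε * U.card / Fintype.card ι) * d x + ε / Fintype.card ι * (U.card * d x) :=
        add_le_add le_rfl (mul_le_mul_of_nonneg_left h1 hq)
    _ = d x := by ring

/-- **Domination of the iterates by a super-solution plus the excess iterate**: with `w₀ = (R − d)₊` (which vanishes
at the uncovered cells by (S2)), `stepD^m R ≤ d + step^m w₀` pointwise — `stepD` is affine with linear part `step`,
monotone, and `stepD d ≤ d`. [cite: Follmer1988, Ch. I (2.7)–(2.11)] -/
theorem iterate_stepD_le (hk : ∀ c y x, 0 ≤ k c y x) {ε : ℝ} (hε0 : 0 ≤ ε) (hε1 : ε ≤ 1)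
    {step stepD : (ι → ℝ) → ι → ℝ}
    (hstep : ∀ a x, step a x = (1 - ε * U.card / Fintype.card ι) * a x +
      ε / Fintype.card ι * ∑ c ∈ U, (if x ∈ win c then ∑ y, k c y x * a y else a x))
    (hstepD : ∀ a x, stepD a x = (1 - ε * U.card / Fintype.card ι) * a x +
      ε / Fintype.card ι * ∑ c ∈ U, ((if x ∈ win c then ∑ y, k c y x * a y else a x) +
        (if x ∈ win c then κ c x else 0)))
    {d : ι → ℝ} (hdS : ∀ c ∈ U, ∀ x ∈ win c, ∑ y, k c y x * d y + κ c x ≤ d x) (m : ℕ) (x : ι) :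
    stepD^[m] (fun _ => R) x ≤ d x + step^[m] (fun y => max (R - d y) 0) x := by
  -- `stepD a = step a + (ε/|ι|) G`
  have hSD : ∀ a x, stepD a x = step a x +
      ε / Fintype.card ι * ∑ c ∈ U, (if x ∈ win c then κ c x else 0) := fun a x => by
    rw [hstepD, hstep, Finset.sum_add_distrib]; ring
  induction m generalizing x with
  | zero =>
    simp only [Function.iterate_zero, id_eq]
    have := le_max_left (R - d x) 0
    linarith
  | succ m ih =>
    rw [Function.iterate_succ_apply', Function.iterate_succ_apply', hSD]
    have hmono := step_mono hk hε0 hε1 hstep ih x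
    rw [step_add hstep] at hmono
    have hfix := stepD_le_of_superSolution hε0 hstepD hdS x
    rw [hSD] at hfix
    linarith

/-! ### The comparison theorem under the per-window received sum -/

/-- **THE WINDOW COMPARISON THEOREM WITH A SUPER-SOLUTION (and defects).**  Two monotone-normalised functionals,
`E₁` invariant and `E₂` ALMOST invariant (defect array `κ ≥ 0`) under the usable window operators; window dusting data
(`hlip0`, `hosc`, `hT`, `hdust`); the PER-WINDOW received sum `Σ_y k c y x ≤ γ₀ < 1` (usable `c`, `x ∈ win c`); and a
nonnegative super-solution `d`: (S1) `Σ_y k c y x d y + κ c x ≤ d x` for usable `c ∋ x`, (S2) `R ≤ d x` at every cell in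
no usable window.  Then every admissible `F` with Lipschitz vector `δ` satisfies `|E₁ F − E₂ F| ≤ Σ_x d x δ x`.
PROOF: the iterates of the step with defects are estimates, dominated by `d + β^m R` (`β = 1 − (1−γ₀)/|ι| < 1`,
laziness `ε = 1`); `m → ∞`. [cite: Follmer1988, Ch. I Theorem (2.8) and Remark (2.11)] -/
theorem abs_sub_le_superSolution (hR : 0 ≤ R) (hlip0 : ∀ ⦃F : Ω → ℝ⦄ ⦃δ : ι → ℝ⦄, Lip F δ → ∀ x, 0 ≤ δ x)
    (hosc : ∀ ⦃F : Ω → ℝ⦄ ⦃δ : ι → ℝ⦄, Adm F → Lip F δ → ∀ σ τ, |F σ - F τ| ≤ R * ∑ x, δ x)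
    (hk : ∀ c y x, 0 ≤ k c y x) (hκ0 : ∀ c x, 0 ≤ κ c x) (hT : ∀ ⦃F : Ω → ℝ⦄ (c : ι), Adm F → Adm (T c F))
    (hdust : ∀ ⦃F : Ω → ℝ⦄ ⦃δ : ι → ℝ⦄ (c : ι), Adm F → Lip F δ →
      Lip (T c F) fun y => if y ∈ win c then 0 else δ y + ∑ x ∈ win c, k c y x * δ x)
    (h₁le : ∀ ⦃F : Ω → ℝ⦄ ⦃M : ℝ⦄, Adm F → (∀ σ, F σ ≤ M) → E₁ F ≤ M)
    (h₁ge : ∀ ⦃F : Ω → ℝ⦄ ⦃M : ℝ⦄, Adm F → (∀ σ, M ≤ F σ) → M ≤ E₁ F)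
    (h₁T : ∀ ⦃F : Ω → ℝ⦄ (c : ι), c ∈ U → Adm F → E₁ (T c F) = E₁ F)
    (h₂le : ∀ ⦃F : Ω → ℝ⦄ ⦃M : ℝ⦄, Adm F → (∀ σ, F σ ≤ M) → E₂ F ≤ M)
    (h₂ge : ∀ ⦃F : Ω → ℝ⦄ ⦃M : ℝ⦄, Adm F → (∀ σ, M ≤ F σ) → M ≤ E₂ F)
    (h₂D : ∀ ⦃F : Ω → ℝ⦄ ⦃δ : ι → ℝ⦄ (c : ι), c ∈ U → Adm F → Lip F δ →
      |E₂ (T c F) - E₂ F| ≤ ∑ x ∈ win c, κ c x * δ x)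
    {γ₀ : ℝ} (hγ₀ : 0 ≤ γ₀) (hγ₁ : γ₀ < 1) (hsumw : ∀ c ∈ U, ∀ x ∈ win c, ∑ y, k c y x ≤ γ₀)
    {d : ι → ℝ} (hd0 : ∀ x, 0 ≤ d x) (hdS : ∀ c ∈ U, ∀ x ∈ win c, ∑ y, k c y x * d y + κ c x ≤ d x)
    (hdR : ∀ x, (∀ c ∈ U, x ∉ win c) → R ≤ d x)
    {F : Ω → ℝ} {δ : ι → ℝ} (hF : Adm F) (hδ : Lip F δ) :
    |E₁ F - E₂ F| ≤ ∑ x, d x * δ x := by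
  -- laziness `ε = 1`; the two steps
  set step : (ι → ℝ) → ι → ℝ := fun a x => (1 - (1 : ℝ) * U.card / Fintype.card ι) * a x +
    1 / Fintype.card ι * ∑ c ∈ U, (if x ∈ win c then ∑ y, k c y x * a y else a x) with hstep_def
  have hstep : ∀ a x, step a x = (1 - (1 : ℝ) * U.card / Fintype.card ι) * a x +
      1 / Fintype.card ι * ∑ c ∈ U, (if x ∈ win c then ∑ y, k c y x * a y else a x) := fun a x => rfl
  set stepD : (ι → ℝ) → ι → ℝ := fun a x => (1 - (1 : ℝ) * U.card / Fintype.card ι) * a x +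
    1 / Fintype.card ι * ∑ c ∈ U, ((if x ∈ win c then ∑ y, k c y x * a y else a x) +
      (if x ∈ win c then κ c x else 0)) with hstepD_def
  have hstepD : ∀ a x, stepD a x = (1 - (1 : ℝ) * U.card / Fintype.card ι) * a x +
      1 / Fintype.card ι * ∑ c ∈ U, ((if x ∈ win c then ∑ y, k c y x * a y else a x) +
        (if x ∈ win c then κ c x else 0)) := fun a x => rfl
  have hδ0 := hlip0 hδ
  set β : ℝ := 1 - 1 * (1 - γ₀) / Fintype.card ι with hβ
  -- the excess `w₀ = (R - d)₊` vanishes at the uncovered cells and is `≤ R`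
  set w₀ : ι → ℝ := fun y => max (R - d y) 0 with hw₀
  have hw00 : ∀ y, 0 ≤ w₀ y := fun y => le_max_right _ _
  have hw0R : ∀ y, w₀ y ≤ R := fun y => max_le (by linarith [hd0 y]) hR
  have hw0z : ∀ y, (∀ c ∈ U, y ∉ win c) → w₀ y = 0 := fun y hy =>
    max_eq_right (by linarith [hdR y hy])
  -- for every `m`: `|E₁ F − E₂ F| ≤ Σ d δ + β^m R Σ δ`
  have hm : ∀ m : ℕ, |E₁ F - E₂ F| ≤ ∑ x, d x * δ x + β ^ m * R * ∑ x, δ x := by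
    intro m
    refine (iterate_stepD_estimate hR hlip0 hosc hk hκ0 hT hdust h₁le h₁ge h₁T h₂le h₂ge h₂D zero_le_one le_rfl
      hstepD m hF hδ).trans ?_
    rw [Finset.mul_sum, ← Finset.sum_add_distrib]
    refine Finset.sum_le_sum fun x _ => ?_
    have h1 := iterate_stepD_le (R := R) hk zero_le_one le_rfl hstep hstepD hdS m x
    have h2 := (iterate_step_excess_le hk zero_le_one le_rfl hstep hγ₀ hγ₁.le hsumw hR hw00 hw0R hw0z m x).2.1
    have h3 : stepD^[m] (fun _ => R) x ≤ d x + β ^ m * R := by linarith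
    nlinarith [hδ0 x]
  -- `m → ∞`
  have hsum0 : 0 ≤ ∑ x, δ x := Finset.sum_nonneg fun x _ => hδ0 x
  rcases isEmpty_or_nonempty ι with hι | hι
  · have h := hm 0
    simp only [Finset.univ_eq_empty, Finset.sum_empty, mul_zero, add_zero] at h ⊢
    exact h
  have hιpos : (0 : ℝ) < Fintype.card ι := by exact_mod_cast Fintype.card_pos
  have hβ0 : 0 ≤ β := by
    rw [hβ, sub_nonneg, div_le_one hιpos, one_mul]
    have h1 : (1 : ℝ) ≤ Fintype.card ι := by exact_mod_cast Fintype.card_pos (α := ι)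
    linarith
  have hβ1 : β < 1 := by
    rw [hβ, sub_lt_self_iff, one_mul]
    exact div_pos (by linarith) hιpos
  refine le_of_forall_pos_le_add fun η hη => ?_
  obtain ⟨m, hmη⟩ := exists_pow_lt_of_lt_one (show 0 < η / (R * ∑ x, δ x + 1) by positivity) hβ1
  refine (hm m).trans (add_le_add le_rfl ?_)
  have h1 : β ^ m * R * ∑ x, δ x ≤ β ^ m * (R * ∑ x, δ x + 1) := by
    rw [mul_assoc]; exact mul_le_mul_of_nonneg_left (by linarith) (pow_nonneg hβ0 m)
  have h2 : β ^ m * (R * ∑ x, δ x + 1) ≤ η := by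
    have := (lt_div_iff₀ (show (0 : ℝ) < R * ∑ x, δ x + 1 by positivity)).1 hmη
    linarith
  exact h1.trans h2

/-- **GEOMETRIC DECAY ALONG A PROFILE** (no defects: `E₂` invariant under the usable window operators).  Under the
per-window received sum `≤ γ₀ < 1`, every cell in its own window, and a profile `ℓ : ι → ℕ` such that every window
through a cell of positive profile is usable and `ℓ x ≤ ℓ y + 1` whenever `y` influences `x ∈ win c` through a usable
`c`: `|E₁ F − E₂ F| ≤ R Σ_x γ₀^{ℓ x} δ x` (the super-solution `d x = R γ₀^{ℓ x}`).  In particular, if `δ` lives on cells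
of profile `≥ L₀`: `|E₁ F − E₂ F| ≤ R γ₀^{L₀} Σ_x δ x` — rate `log(1/γ₀)` per profile level, constant `R`
(compare `abs_sub_le_exp`: `2R e^{−(1−γ₀)² L₀/(2(2γ₀N⋆+1))}` under the averaged condition).
[cite: Follmer1988, Ch. I Theorem (2.8) and Remark (2.11)] -/
theorem abs_sub_le_geometric (hR : 0 ≤ R) (hlip0 : ∀ ⦃F : Ω → ℝ⦄ ⦃δ : ι → ℝ⦄, Lip F δ → ∀ x, 0 ≤ δ x)
    (hosc : ∀ ⦃F : Ω → ℝ⦄ ⦃δ : ι → ℝ⦄, Adm F → Lip F δ → ∀ σ τ, |F σ - F τ| ≤ R * ∑ x, δ x)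
    (hk : ∀ c y x, 0 ≤ k c y x) (hT : ∀ ⦃F : Ω → ℝ⦄ (c : ι), Adm F → Adm (T c F))
    (hdust : ∀ ⦃F : Ω → ℝ⦄ ⦃δ : ι → ℝ⦄ (c : ι), Adm F → Lip F δ →
      Lip (T c F) fun y => if y ∈ win c then 0 else δ y + ∑ x ∈ win c, k c y x * δ x)
    (h₁le : ∀ ⦃F : Ω → ℝ⦄ ⦃M : ℝ⦄, Adm F → (∀ σ, F σ ≤ M) → E₁ F ≤ M)
    (h₁ge : ∀ ⦃F : Ω → ℝ⦄ ⦃M : ℝ⦄, Adm F → (∀ σ, M ≤ F σ) → M ≤ E₁ F)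
    (h₁T : ∀ ⦃F : Ω → ℝ⦄ (c : ι), c ∈ U → Adm F → E₁ (T c F) = E₁ F)
    (h₂le : ∀ ⦃F : Ω → ℝ⦄ ⦃M : ℝ⦄, Adm F → (∀ σ, F σ ≤ M) → E₂ F ≤ M)
    (h₂ge : ∀ ⦃F : Ω → ℝ⦄ ⦃M : ℝ⦄, Adm F → (∀ σ, M ≤ F σ) → M ≤ E₂ F)
    (h₂T : ∀ ⦃F : Ω → ℝ⦄ (c : ι), c ∈ U → Adm F → E₂ (T c F) = E₂ F)
    {γ₀ : ℝ} (hγ₀ : 0 ≤ γ₀) (hγ₁ : γ₀ < 1) (hsumw : ∀ c ∈ U, ∀ x ∈ win c, ∑ y, k c y x ≤ γ₀)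
    (hself : ∀ x, x ∈ win x) (ℓ : ι → ℕ) (hU : ∀ x, ℓ x ≠ 0 → ∀ c, x ∈ win c → c ∈ U)
    (hℓ : ∀ c ∈ U, ∀ x ∈ win c, ∀ y, k c y x ≠ 0 → ℓ x ≤ ℓ y + 1)
    {F : Ω → ℝ} {δ : ι → ℝ} (hF : Adm F) (hδ : Lip F δ) :
    |E₁ F - E₂ F| ≤ R * ∑ x, γ₀ ^ ℓ x * δ x := by
  have key := abs_sub_le_superSolution (κ := fun _ _ => 0) hR hlip0 hosc hk (fun _ _ => le_rfl) hT hdust h₁le h₁ge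
    h₁T h₂le h₂ge (fun F δ c hc hF' hδ' => by
      rw [h₂T c hc hF', sub_self, abs_zero]
      exact Finset.sum_nonneg fun x _ => mul_nonneg le_rfl (hlip0 hδ' x)) hγ₀ hγ₁ hsumw
    (d := fun x => R * γ₀ ^ ℓ x) (fun x => mul_nonneg hR (pow_nonneg hγ₀ _)) ?_ ?_ hF hδ
  · rw [Finset.mul_sum]
    refine key.trans (le_of_eq (Finset.sum_congr rfl fun x _ => by ring))
  · -- (S1): along a usable window the profile drops by at most one
    intro c hc x hxc
    rw [add_zero]
    have hterm : ∀ y, k c y x * (R * γ₀ ^ ℓ y) ≤ k c y x * (R * γ₀ ^ (ℓ x - 1)) := fun y => by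
      by_cases hk0 : k c y x = 0
      · rw [hk0, zero_mul, zero_mul]
      · refine mul_le_mul_of_nonneg_left (mul_le_mul_of_nonneg_left ?_ hR) (hk c y x)
        exact pow_le_pow_of_le_one hγ₀ hγ₁.le (by have := hℓ c hc x hxc y hk0; omega)
    calc ∑ y, k c y x * (R * γ₀ ^ ℓ y) ≤ ∑ y, k c y x * (R * γ₀ ^ (ℓ x - 1)) := Finset.sum_le_sum fun y _ => hterm y
      _ = (∑ y, k c y x) * (R * γ₀ ^ (ℓ x - 1)) := by rw [Finset.sum_mul]
      _ ≤ γ₀ * (R * γ₀ ^ (ℓ x - 1)) := mul_le_mul_of_nonneg_right (hsumw c hc x hxc) (by positivity)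
      _ ≤ R * γ₀ ^ ℓ x := by
          rcases Nat.eq_zero_or_pos (ℓ x) with h0 | hpos
          · rw [h0]; simp only [Nat.zero_sub, pow_zero, mul_one]; nlinarith
          · have : γ₀ * γ₀ ^ (ℓ x - 1) = γ₀ ^ ℓ x := by
              rw [← pow_succ']; congr 1; omega
            rw [← mul_assoc, mul_comm γ₀ R, mul_assoc, this]
  · -- (S2): a cell in no usable window has profile `0`
    intro x hx
    have hx0 : ℓ x = 0 := by
      by_contra h
      exact hx x (hU x h x (hself x)) (hself x)
    rw [hx0, pow_zero, mul_one]

end Literature.Probability.LatticeModels.DobrushinShlosman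

end
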